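import Mathlib
import Summits.ValiantsHypothesis.ValiantsHypothesis.Theorems.BarrierLeverPartitionMinorsHitByVPHiddenStatesGradedColex

/-!
# Route BarrierLever — item `PartitionMinorsHitByVP` (stmt-ValiantsHypothesis-19717), line `hidden-states`:
# CONJECTURE MDS½ (GC½ for ARBITRARY row families) ⇒ the REGISTERED all-`u` node in the whole upper half, ONE piece, `K = h`

Helper file (`--supports stmt-ValiantsHypothesis-19717`; cell valiant-natproofs, rung V4, 𝒟-side door (c), registered line
`Cruxes/PartitionMinorsHitByVP/Lines/hidden_states.lean` v8; prover seat val-np-p6 gen 14). Definition-free; closes NO item.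
The all-`u` twin of `BallDiag.universalJoinWideLower_upperHalf_of_gc` (p636831).

CONJECTURE MDS½ (= GC-ALL½; typed verbatim as the hypothesis `H` below, NOT asserted). For every `h ≥ 1` and `2^{h−1} ≤ r ≤ 2^h`, the
one-piece graded-colex threshold family of size `r` on `K = h` states (`BallDiag.exists_gcFamily`) has a table making the hidden-point matrix
nonsingular against EVERY injective row family `u : Fin r → Finset (Fin h)` — no lower-set hypothesis. Equivalent forms (memo val-np-p6 g14
§8(ii)): the `2^h × r` multilinear moment matrix `[p_k^S]` of the hidden points has every `r × r` minor nonzero; the Hadamard monomials of `h`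
generic affine functions on `X_{F_r}` form a FULL-SPARK frame of `ℂ^r`; the code of multilinear polynomials vanishing on the hidden points is
MDS — no multilinear polynomial with `≤ r` monomials vanishes on the `r` hidden points. EVIDENCE (kit, --workitem 19717, exact rank mod p):
exact half `h = 7..11` and `h = 9` at `r ∈ {293, 307, 384}`: structured non-lower families (top layers, upper colex segment, single layers,
middle layers, stars, up-sets, parity classes), random families and random-walk corank search — 0 singular (j311984–j311989, j312027/8);
down-set censuses of val-np-p6 g13 (2 235, h ≤ 12) and this seat (h = 11..15 structured; hill-climbs h = 9..12). WHY IT MIGHT FAIL: a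
non-lower family concentrating high-degree monomials on few coordinates could meet a tensor-level (shallow-piece) rank bound of the
`…SimplexJoinTwoDeep` type; none is known for `K = h` at `r ≥ 2^{h−1}`. Below the half it is FALSE already for down-sets (shadow
obstruction, p639205).

* **`universalJoinWide_upperHalf_of_gcAll`** — MDS½ ⇒ the body of the registered `Stmt.stub_universalJoinWide` at every `(h, r)` with
  `h ≥ 1`, `2^{h−1} ≤ r ≤ 2^h` (one piece, `K = h`, `m = 1`).
* `gcAll_implies_gc` — MDS½ ⇒ GC½ (the hypothesis of p636831), trivially.

WHAT THIS IS NOT: no proof of MDS½ or GC½; nothing below `2^{h−1}`; nothing on crux 14610 or VP ≠ VNP.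
-/

set_option linter.dupNamespace false

namespace Summit.ValiantsHypothesis.ValiantsHypothesis.Theorems.BarrierLever.HiddenStates

open Finset

noncomputable section

namespace BallDiag

/-- **THE UPPER HALF OF THE ALL-`u` NODE MODULO MDS½.** If the graded-colex one-piece family serves EVERY injective row family of size `r`
whenever `2^{h−1} ≤ r ≤ 2^h` (Conjecture MDS½ = GC-ALL½, the hypothesis), then the body of the registered `Stmt.stub_universalJoinWide`
holds at every such `(h, r)` with `h ≥ 1`, by a design with ONE piece and `K = h` states. -/
theorem universalJoinWide_upperHalf_of_gcAll
    (H : ∀ h r : ℕ, 1 ≤ h → 2 ^ (h - 1) ≤ r → r ≤ 2 ^ h →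
      ∀ cols : Fin r → Finset (Fin h), Function.Injective cols →
        (∀ k J, J ∉ Set.range cols → ∑ q ∈ cols k, (2 ^ h + 2 ^ (q : ℕ)) < ∑ q ∈ J, (2 ^ h + 2 ^ (q : ℕ))) →
        ∀ u : Fin r → Finset (Fin h), Function.Injective u →
          ∃ tx : Option (Fin h) → Fin h → ℂ,
            (Matrix.of fun i k : Fin r => ∏ a ∈ u i, (tx none a + ∑ q ∈ cols k, tx (some q) a)).det ≠ 0)
    (h r : ℕ) (h1 : 1 ≤ h) (hlo : 2 ^ (h - 1) ≤ r) (hhi : r ≤ 2 ^ h) :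
    ∃ (m K : ℕ) (W : Fin m → ℕ) (wt : Fin m → Fin K → ℕ) (e : Fin r → Fin m × Finset (Fin K)),
      m ≤ h + h ∧ K ≤ h * h * h ∧ Function.Injective e ∧
      (∀ x : Fin m × Finset (Fin K), x ∉ Set.range e →
        ∀ i, W (e i).1 + ∑ k ∈ (e i).2, wt (e i).1 k < W x.1 + ∑ k ∈ x.2, wt x.1 k) ∧
      ∀ u : Fin r → Finset (Fin h), Function.Injective u →
        ∃ tx : Fin m → Option (Fin K) → Fin h → ℂ,
          (Matrix.of fun i k : Fin r =>
            ∏ a ∈ u i, (tx (e k).1 none a + ∑ q ∈ (e k).2, tx (e k).1 (some q) a)).det ≠ 0 := by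
  obtain ⟨cols, hinj, hgc⟩ := exists_gcFamily h r hhi
  refine ⟨1, h, fun _ => 0, fun _ q => 2 ^ h + 2 ^ (q : ℕ), fun k => ((0 : Fin 1), cols k), by omega, ?_, ?_,
    gcDesign_threshold h r cols hgc, ?_⟩
  · calc h = h * 1 * 1 := by ring
      _ ≤ h * h * h := by gcongr
  · intro k k' hkk
    exact hinj (Prod.ext_iff.mp hkk).2
  · intro u hu
    obtain ⟨tx, htx⟩ := H h r h1 hlo hhi cols hinj hgc u hu
    exact ⟨fun _ => tx, htx⟩

/-- **MDS½ ⇒ GC½** (the hypothesis of `universalJoinWideLower_upperHalf_of_gc`, p636831): drop the lower-set hypothesis. -/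
theorem gcAll_implies_gc
    (H : ∀ h r : ℕ, 1 ≤ h → 2 ^ (h - 1) ≤ r → r ≤ 2 ^ h →
      ∀ cols : Fin r → Finset (Fin h), Function.Injective cols →
        (∀ k J, J ∉ Set.range cols → ∑ q ∈ cols k, (2 ^ h + 2 ^ (q : ℕ)) < ∑ q ∈ J, (2 ^ h + 2 ^ (q : ℕ))) →
        ∀ u : Fin r → Finset (Fin h), Function.Injective u →
          ∃ tx : Option (Fin h) → Fin h → ℂ,
            (Matrix.of fun i k : Fin r => ∏ a ∈ u i, (tx none a + ∑ q ∈ cols k, tx (some q) a)).det ≠ 0) :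
    ∀ h r : ℕ, 1 ≤ h → 2 ^ (h - 1) ≤ r → r ≤ 2 ^ h →
      ∀ cols : Fin r → Finset (Fin h), Function.Injective cols →
        (∀ k J, J ∉ Set.range cols → ∑ q ∈ cols k, (2 ^ h + 2 ^ (q : ℕ)) < ∑ q ∈ J, (2 ^ h + 2 ^ (q : ℕ))) →
        ∀ u : Fin r → Finset (Fin h), Function.Injective u → IsLowerSet (Set.range u) →
          ∃ tx : Option (Fin h) → Fin h → ℂ,
            (Matrix.of fun i k : Fin r => ∏ a ∈ u i, (tx none a + ∑ q ∈ cols k, tx (some q) a)).det ≠ 0 :=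
  fun h r h1 hlo hhi cols hinj hgc u hu _ => H h r h1 hlo hhi cols hinj hgc u hu

end BallDiag

end

end Summit.ValiantsHypothesis.ValiantsHypothesis.Theorems.BarrierLever.HiddenStates
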